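import Mathlib
import HarnessLib

/-!
# Route `F4SubCurvatureDoor`, crux `SubCurvatureKernel` ⟨stmt-QuantumFields-23036⟩ — FIBRE AVERAGING:
# a diagonally translation-invariant two-point density is a kernel of the difference variable

Helper file (`--supports stmt-QuantumFields-23036 --as helper`; free-hands seat `ym-line-frs-p2` g17, piece (K5′) of the kernel-extraction
clause (K) of the soft-half scope, HOME INBOX 2026-08-29T16:34:27Z / 16:47:40Z).  Definition-free, GENERIC measure theory (no lattice input),
Mathlib only, 0 sorry, standard axioms.  No item is closed; no summit, no crux and no mass gap is proved by this file.

WHAT.  Kernel extraction for `SubCurvatureKernel` (clause 6: `S₁ 2 F = ∫ K(x₀ − x₁) F(x) dx`) factors as: (K-core, LEAD sfw-p2 g76) an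
`L¹`-bounded functional has an essentially bounded two-variable density `W`; (K4′) translation invariance of `S₁ 2` (✓p733041) makes `W`
invariant a.e. under every DIAGONAL translation `x ↦ x + (t, t)`; (K5′, THIS FILE) such a `W` IS a function of `x₀ − x₁` almost everywhere:

* `exists_kernel_of_diag_translate_invariant` — if `W : (ℝ⁴)² → ℂ` is measurable, bounded by `B`, and for EVERY `t ∈ ℝ⁴`,
  `W (x + (t,t)) = W x` for a.e. `x`, then there is a measurable `K : ℝ⁴ → ℂ`, bounded by `B`, with `W x = K (x₀ − x₁)` for a.e. `x`.
  Construction: `K u := ∫ W(u + v, v) χ(v) dv` with `χ` a normed bump (average over the fibre); proof: Fubini in the form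
  `ae_ae_comm` turns «∀ t, a.e. x» into «a.e. x, a.e. t», and on that full-measure set the fibre average reproduces `W x` after the
  substitution `v = x₁ + t` (translation invariance of Lebesgue measure).

References: standard (disintegration of translation-invariant kernels; e.g. L. Hörmander, ALPDO I, §4.2, translation-invariant
distributions are convolutions) — here in the bounded-measurable setting, elementary.

HONEST LABEL: one measure-theoretic piece of clause (K) of the SOFT half of ⟨23036⟩; (K) proper also needs the extension/K-core/gluing
steps, (C) continuity and — above all — the SUB-CURVATURE clause remain OPEN; ⟨23036⟩ is an open problem; the Yang–Mills mass gap is NOT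
proved; no summit is proved by a line.
-/

set_option autoImplicit false

noncomputable section

open scoped BigOperators ContDiff
open MeasureTheory Filter Topology Set

namespace Summit.QuantumFields.YangMills.Theorems.F4SubCurvatureDoorSubCurvatureKernelFibre

/-- The shear `(u, v) ↦ (u + v, v)` into two-point configurations is continuous. -/
theorem continuous_shear : Continuous fun p : (EuclideanSpace ℝ (Fin 4)) × (EuclideanSpace ℝ (Fin 4)) => (![p.1 + p.2, p.2] : Fin 2 → (EuclideanSpace ℝ (Fin 4))) := by
  refine continuous_pi fun i => ?_
  fin_cases i
  · exact (continuous_fst.add continuous_snd).congr fun p => by simp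
  · exact continuous_snd.congr fun p => by simp

/-- The shear `(u, v) ↦ (u + v, v)` into two-point configurations is measurable. -/
theorem measurable_shear : Measurable fun p : (EuclideanSpace ℝ (Fin 4)) × (EuclideanSpace ℝ (Fin 4)) => (![p.1 + p.2, p.2] : Fin 2 → (EuclideanSpace ℝ (Fin 4))) :=
  continuous_shear.measurable

/-- The diagonal translate `x + (t,t)` of the sheared point `(u + x₁, x₁)`: bookkeeping identity
`![x₀ − x₁ + (x₁ + t), x₁ + t] = x + (t, t)`. -/
theorem shear_sub_add (x : Fin 2 → (EuclideanSpace ℝ (Fin 4))) (t : (EuclideanSpace ℝ (Fin 4))) :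
    (![x 0 - x 1 + (x 1 + t), x 1 + t] : Fin 2 → (EuclideanSpace ℝ (Fin 4))) = x + fun _ => t := by
  funext i
  fin_cases i
  · simp; abel
  · simp

/-- ★ **FIBRE AVERAGING.**  A bounded measurable two-point density on `(ℝ⁴)²` which, for every `t`, is a.e. invariant under the diagonal
translation `x ↦ x + (t,t)`, is almost everywhere a (bounded measurable) function of the difference variable `x₀ − x₁`. [folklore] -/
theorem exists_kernel_of_diag_translate_invariant (W : (Fin 2 → (EuclideanSpace ℝ (Fin 4))) → ℂ) (hWm : Measurable W) {B : ℝ}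
    (hWb : ∀ x, ‖W x‖ ≤ B) (hinv : ∀ t : (EuclideanSpace ℝ (Fin 4)), ∀ᵐ x : Fin 2 → (EuclideanSpace ℝ (Fin 4)), W (x + fun _ => t) = W x) :
    ∃ K : (EuclideanSpace ℝ (Fin 4)) → ℂ, Measurable K ∧ (∀ u, ‖K u‖ ≤ B) ∧ ∀ᵐ x : Fin 2 → (EuclideanSpace ℝ (Fin 4)), W x = K (x 0 - x 1) := by
  -- a normed bump in the fibre variable
  let b : ContDiffBump (0 : (EuclideanSpace ℝ (Fin 4))) := ⟨1, 2, one_pos, one_lt_two⟩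
  set χ : (EuclideanSpace ℝ (Fin 4)) → ℝ := b.normed volume with hχ
  have hχc : Continuous χ := b.continuous_normed
  have hχi : Integrable χ := b.integrable_normed
  have hχ1 : ∫ v, χ v = 1 := b.integral_normed
  have hχ0 : ∀ v, 0 ≤ χ v := fun v => b.nonneg_normed v
  have hB : 0 ≤ B := le_trans (norm_nonneg _) (hWb 0)
  -- the fibre average
  set G : (EuclideanSpace ℝ (Fin 4)) × (EuclideanSpace ℝ (Fin 4)) → ℂ := fun p => W ![p.1 + p.2, p.2] * (χ p.2 : ℂ) with hG
  have hGm : Measurable G :=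
    (hWm.comp measurable_shear).mul (Complex.measurable_ofReal.comp (hχc.measurable.comp measurable_snd))
  set K : (EuclideanSpace ℝ (Fin 4)) → ℂ := fun u => ∫ v, G (u, v) with hK
  have hKm : Measurable K := (hGm.stronglyMeasurable.integral_prod_right' (ν := volume)).measurable
  -- pointwise bound `‖K u‖ ≤ B`
  have hKb : ∀ u, ‖K u‖ ≤ B := by
    intro u
    have hle : ∀ᵐ v ∂(volume : Measure (EuclideanSpace ℝ (Fin 4))), ‖G (u, v)‖ ≤ B * χ v := Eventually.of_forall fun v => by
      simp only [hG, norm_mul, Complex.norm_real, Real.norm_eq_abs, abs_of_nonneg (hχ0 v)]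
      exact mul_le_mul_of_nonneg_right (hWb _) (hχ0 v)
    calc ‖K u‖ ≤ ∫ v, B * χ v := norm_integral_le_of_norm_le (hχi.const_mul B) hle
      _ = B := by rw [integral_const_mul, hχ1, mul_one]
  refine ⟨K, hKm, hKb, ?_⟩
  -- Fubini: «∀ t, a.e. x» ⇒ «a.e. x, a.e. t»
  have hmeas : MeasurableSet {p : (EuclideanSpace ℝ (Fin 4)) × (Fin 2 → (EuclideanSpace ℝ (Fin 4))) | W (p.2 + fun _ => p.1) = W p.2} := by
    refine measurableSet_eq_fun (hWm.comp ?_) (hWm.comp measurable_snd)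
    exact measurable_snd.add (measurable_pi_lambda _ fun _ => measurable_fst)
  have hae : ∀ᵐ x : Fin 2 → (EuclideanSpace ℝ (Fin 4)), ∀ᵐ t : (EuclideanSpace ℝ (Fin 4)), W (x + fun _ => t) = W x :=
    (Measure.ae_ae_comm (μ := (volume : Measure (EuclideanSpace ℝ (Fin 4)))) (ν := (volume : Measure (Fin 2 → (EuclideanSpace ℝ (Fin 4)))))
      (p := fun t x => W (x + fun _ => t) = W x) hmeas).1 (Eventually.of_forall hinv)
  refine hae.mono fun x hx => ?_
  -- on the good set: the fibre average reproduces `W x`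
  have hsub : K (x 0 - x 1) = ∫ t, W (x + fun _ => t) * (χ (x 1 + t) : ℂ) := by
    simp only [hK, hG]
    rw [← integral_add_left_eq_self (μ := (volume : Measure (EuclideanSpace ℝ (Fin 4)))) _ (x 1)]
    refine integral_congr_ae (Eventually.of_forall fun t => ?_)
    simp only [shear_sub_add]
  have hconst : ∫ t, W (x + fun _ => t) * (χ (x 1 + t) : ℂ) = ∫ t, W x * (χ (x 1 + t) : ℂ) :=
    integral_congr_ae (hx.mono fun t ht => by beta_reduce; rw [ht])
  have hone : ∫ t, W x * (χ (x 1 + t) : ℂ) = W x := by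
    rw [integral_const_mul, integral_complex_ofReal, integral_add_left_eq_self (μ := (volume : Measure (EuclideanSpace ℝ (Fin 4)))) χ (x 1),
      hχ1, Complex.ofReal_one, mul_one]
  rw [hsub, hconst, hone]

/-- **Corollary with a region.**  If the invariance and the interest are restricted to configurations whose difference variable lies in a
set `V` (e.g. `V = {δ < ‖u‖}`): apply the theorem to `W · 1_{x₀ − x₁ ∈ V}` (the region is invariant under diagonal translations).
[folklore] -/
theorem exists_kernel_of_diag_translate_invariant_on (V : Set (EuclideanSpace ℝ (Fin 4))) (hV : MeasurableSet V) (W : (Fin 2 → (EuclideanSpace ℝ (Fin 4))) → ℂ)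
    (hWm : Measurable W) {B : ℝ} (hWb : ∀ x, ‖W x‖ ≤ B)
    (hinv : ∀ t : (EuclideanSpace ℝ (Fin 4)), ∀ᵐ x : Fin 2 → (EuclideanSpace ℝ (Fin 4)), x 0 - x 1 ∈ V → W (x + fun _ => t) = W x) :
    ∃ K : (EuclideanSpace ℝ (Fin 4)) → ℂ, Measurable K ∧ (∀ u, ‖K u‖ ≤ B) ∧ ∀ᵐ x : Fin 2 → (EuclideanSpace ℝ (Fin 4)), x 0 - x 1 ∈ V → W x = K (x 0 - x 1) := by
  classical
  have hB : 0 ≤ B := le_trans (norm_nonneg _) (hWb 0)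
  set Ω : Set (Fin 2 → (EuclideanSpace ℝ (Fin 4))) := {x | x 0 - x 1 ∈ V} with hΩ
  have hΩm : MeasurableSet Ω := hV.preimage ((measurable_pi_apply 0).sub (measurable_pi_apply 1))
  set W' : (Fin 2 → (EuclideanSpace ℝ (Fin 4))) → ℂ := Ω.indicator W with hW'
  have hW'm : Measurable W' := hWm.indicator hΩm
  have hW'b : ∀ x, ‖W' x‖ ≤ B := fun x => by
    simp only [hW']
    by_cases hx : x ∈ Ω
    · rw [indicator_of_mem hx]; exact hWb x
    · rw [indicator_of_notMem hx, norm_zero]; exact hB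
  have hΩt : ∀ (x : Fin 2 → (EuclideanSpace ℝ (Fin 4))) (t : (EuclideanSpace ℝ (Fin 4))), (x + fun _ => t) ∈ Ω ↔ x ∈ Ω := fun x t => by
    simp only [hΩ, mem_setOf_eq, Pi.add_apply, add_sub_add_right_eq_sub]
  have hinv' : ∀ t : (EuclideanSpace ℝ (Fin 4)), ∀ᵐ x : Fin 2 → (EuclideanSpace ℝ (Fin 4)), W' (x + fun _ => t) = W' x := fun t =>
    (hinv t).mono fun x hx => by
      simp only [hW']
      by_cases hxΩ : x ∈ Ω
      · rw [indicator_of_mem ((hΩt x t).2 hxΩ), indicator_of_mem hxΩ, hx hxΩ]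
      · rw [indicator_of_notMem (fun h => hxΩ ((hΩt x t).1 h)), indicator_of_notMem hxΩ]
  obtain ⟨K, hKm, hKb, hK⟩ := exists_kernel_of_diag_translate_invariant W' hW'm hW'b hinv'
  refine ⟨K, hKm, hKb, hK.mono fun x hx hxV => ?_⟩
  rw [← hx, hW', indicator_of_mem (show x ∈ Ω from hxV)]

end Summit.QuantumFields.YangMills.Theorems.F4SubCurvatureDoorSubCurvatureKernelFibre

end
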